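import Mathlib
import Summits.ValiantsHypothesis.ValiantsHypothesis.Theorems.BarrierLeverPartitionMinorsHitByVPTwoBlockTropical

/-!
# Route BarrierLever — item `PartitionMinorsHitByVP` (stmt-ValiantsHypothesis-19717):
# preliminaries for the m-STRATA DOOR (leading forms of determinants, block-diagonal
# nonsingularity, the convex envelope of the stratum exponents, degree truncation)

Helper file (`--supports stmt-ValiantsHypothesis-19717`; cell valiant-natproofs, rung V4, 𝒟-side,
prover seat val-np-p6 gen 0). Definition-free. Closes NO item.

* `coeff_det_eq_det_coeff` — LEADING FORM OF A DETERMINANT: if `natDegree (A i j) ≤ Φ i + Ψ j`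
  (row and column potentials), the coefficient of `X^{Σ Φ + Σ Ψ}` in `det A` is the determinant of
  the matrix of the coefficients `(A i j).coeff (Φ i + Ψ j)` (every Leibniz term has the same
  degree budget `Σ_j (Φ (σ j) + Ψ j) = Σ Φ + Σ Ψ`).
* `det_ne_zero_of_levels` — a matrix vanishing off the diagonal blocks of a level function
  `lv : ι → ℕ` is nonsingular when its diagonal blocks are (`Matrix.BlockTriangular.det`).
* `envelope_lt` — for monotone cuts `cr` and `K t = -Σ_{s<t} (2·cr (s+1) + 1)`, the affine pieces
  `t ↦ K t + 2 t v` have a STRICT maximum at the level `t₀` of `v` (`cr t₀ < v ≤ cr (t₀+1)`): the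
  exponent bookkeeping that lets ONE evaluation point separate any number of strata.
* `coeff_truncate_partition`, `totalDegree_truncate_le` — the degree-`≤ 2h` truncation
  `Σ_{e ≤ 2h} f^{(e)}` has the same partition-matrix entries `coeff_{x^U y^W}` as `f`
  (so witnesses may be built degree-free and truncated once, at cost `(2h+2)²·L(f) + 2h + 1` by
  `Literature…complexity_sum_homogeneousComponent_le`).

WHAT THIS IS NOT: no layout is certified here (that is `…StrataDoor.lean`); nothing on crux 14610.
-/

set_option linter.dupNamespace false

namespace Summit.ValiantsHypothesis.ValiantsHypothesis.Theorems.BarrierLever.StrataDoor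

open Finset Polynomial
open Summit.ValiantsHypothesis.ValiantsHypothesis.Theorems.BarrierLever.TwoBlock
  (coeff_prod_of_natDegree_le_sum)

/-! ## 1. Leading form of a determinant under row/column potentials -/

/-- **Leading form.** With row potentials `Φ` and column potentials `Ψ` bounding the entry degrees,
the `X^{Σ Φ + Σ Ψ}`-coefficient of `det A` is the determinant of the potential-top coefficients. -/
theorem coeff_det_eq_det_coeff {ι : Type*} [Fintype ι] [DecidableEq ι] (A : Matrix ι ι ℂ[X])
    (Φ Ψ : ι → ℕ) (hdeg : ∀ i j, (A i j).natDegree ≤ Φ i + Ψ j) :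
    A.det.coeff (∑ i, Φ i + ∑ j, Ψ j) = (Matrix.of fun i j => (A i j).coeff (Φ i + Ψ j)).det := by
  classical
  rw [Matrix.det_apply', Matrix.det_apply', finsetSum_coeff]
  refine Finset.sum_congr rfl fun σ _ => ?_
  rw [← C_eq_intCast, coeff_C_mul]
  congr 1
  have hN : ∑ i, Φ i + ∑ j, Ψ j = ∑ j, (Φ (σ j) + Ψ j) := by
    rw [Finset.sum_add_distrib, Equiv.sum_comp σ Φ]
  rw [hN, coeff_prod_of_natDegree_le_sum _ _ _ (fun j _ => hdeg (σ j) j)]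
  rfl

/-! ## 2. Block-diagonal matrices along a level function -/

/-- A matrix vanishing off the diagonal blocks of `lv` is nonsingular if its diagonal blocks are. -/
theorem det_ne_zero_of_levels {ι : Type*} [Fintype ι] [DecidableEq ι] (B : Matrix ι ι ℂ)
    (lv : ι → ℕ) (hoff : ∀ i j, lv i ≠ lv j → B i j = 0)
    (hblk : ∀ t ∈ (Finset.univ : Finset ι).image lv,
      (Matrix.of fun i j : {i // lv i = t} => B i.1 j.1).det ≠ 0) :
    B.det ≠ 0 := by
  have hBT : B.BlockTriangular lv := fun i j hij => hoff i j (ne_of_gt hij)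
  rw [hBT.det]
  exact Finset.prod_ne_zero_iff.mpr fun t ht => by
    rw [Matrix.toSquareBlock_def]
    exact hblk t ht

/-! ## 3. The convex envelope of the stratum exponents -/

/-- One step up below the level: `g t < g (t+1)` for `t < t₀`. -/
theorem envelope_step_up (cr : ℕ → ℤ) (hcr : Monotone cr) (v : ℤ) (t₀ : ℕ) (h1 : cr t₀ < v)
    (t : ℕ) (ht : t < t₀) :
    (-∑ s ∈ Finset.range t, (2 * cr (s + 1) + 1)) + 2 * (t : ℤ) * v <
      (-∑ s ∈ Finset.range (t + 1), (2 * cr (s + 1) + 1)) + 2 * ((t + 1 : ℕ) : ℤ) * v := by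
  have hmono : cr (t + 1) ≤ cr t₀ := hcr (by omega)
  rw [Finset.sum_range_succ]
  push_cast
  nlinarith

/-- One step down at or above the level: `g (t+1) < g t` for `t₀ ≤ t`. -/
theorem envelope_step_down (cr : ℕ → ℤ) (hcr : Monotone cr) (v : ℤ) (t₀ : ℕ)
    (h2 : v ≤ cr (t₀ + 1)) (t : ℕ) (ht : t₀ ≤ t) :
    (-∑ s ∈ Finset.range (t + 1), (2 * cr (s + 1) + 1)) + 2 * ((t + 1 : ℕ) : ℤ) * v <
      (-∑ s ∈ Finset.range t, (2 * cr (s + 1) + 1)) + 2 * (t : ℤ) * v := by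
  have hmono : cr (t₀ + 1) ≤ cr (t + 1) := hcr (by omega)
  rw [Finset.sum_range_succ]
  push_cast
  nlinarith

/-- **Strict envelope.** For monotone cuts and `cr t₀ < v ≤ cr (t₀ + 1)`, the piece `t₀` is the
unique maximiser of `t ↦ -Σ_{s<t} (2 cr (s+1) + 1) + 2 t v`. -/
theorem envelope_lt (cr : ℕ → ℤ) (hcr : Monotone cr) (v : ℤ) (t₀ : ℕ) (h1 : cr t₀ < v)
    (h2 : v ≤ cr (t₀ + 1)) (t : ℕ) (ht : t ≠ t₀) :
    (-∑ s ∈ Finset.range t, (2 * cr (s + 1) + 1)) + 2 * (t : ℤ) * v <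
      (-∑ s ∈ Finset.range t₀, (2 * cr (s + 1) + 1)) + 2 * (t₀ : ℤ) * v := by
  rcases Nat.lt_or_gt_of_ne ht with hlt | hgt
  · -- climb from `t` to `t₀`
    have key : ∀ k : ℕ, t + k + 1 ≤ t₀ →
        (-∑ s ∈ Finset.range t, (2 * cr (s + 1) + 1)) + 2 * (t : ℤ) * v <
          (-∑ s ∈ Finset.range (t + k + 1), (2 * cr (s + 1) + 1)) + 2 * ((t + k + 1 : ℕ) : ℤ) * v := by
      intro k
      induction k with
      | zero =>
        intro hk
        simpa using envelope_step_up cr hcr v t₀ h1 t (by omega)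
      | succ k ih =>
        intro hk
        have h' := ih (by omega)
        have h'' := envelope_step_up cr hcr v t₀ h1 (t + k + 1) (by omega)
        have hcast : ((t + k + 1 : ℕ) : ℤ) = ((t + k + 1 : ℕ) : ℤ) := rfl
        refine lt_trans h' ?_
        have e1 : t + (k + 1) + 1 = t + k + 1 + 1 := by ring
        rw [e1]
        push_cast at h'' ⊢
        linarith
    have := key (t₀ - t - 1) (by omega)
    have e2 : t + (t₀ - t - 1) + 1 = t₀ := by omega
    rw [e2] at this
    exact this
  · -- descend from `t₀` to `t`
    have key : ∀ k : ℕ,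
        (-∑ s ∈ Finset.range (t₀ + k + 1), (2 * cr (s + 1) + 1)) + 2 * ((t₀ + k + 1 : ℕ) : ℤ) * v <
          (-∑ s ∈ Finset.range t₀, (2 * cr (s + 1) + 1)) + 2 * (t₀ : ℤ) * v := by
      intro k
      induction k with
      | zero => simpa using envelope_step_down cr hcr v t₀ h2 t₀ le_rfl
      | succ k ih =>
        have h'' := envelope_step_down cr hcr v t₀ h2 (t₀ + k + 1) (by omega)
        refine lt_trans ?_ ih
        have e1 : t₀ + (k + 1) + 1 = t₀ + k + 1 + 1 := by ring
        rw [e1]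
        push_cast at h'' ⊢
        linarith
    have := key (t - t₀ - 1)
    have e2 : t₀ + (t - t₀ - 1) + 1 = t := by omega
    rw [e2] at this
    exact this

/-! ## 4. Degree truncation keeps the partition-matrix entries -/

/-- The degree of the partition exponent `x^U y^W` is `#U + #W`. -/
theorem degree_partitionExpo {h : ℕ} (U W : Finset (Fin h)) :
    ((∑ a ∈ U, Finsupp.single (Fin.castAdd h a) 1 +
        ∑ c ∈ W, Finsupp.single (Fin.natAdd h c) 1 : Fin (h + h) →₀ ℕ)).degree = U.card + W.card := by
  rw [map_add, map_sum, map_sum]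
  simp [Finsupp.degree_single]

/-- **Truncation keeps the layout entries.** The degree-`≤ h+h` truncation `Σ_{e ≤ h+h} f^{(e)}` has
the same coefficient at every partition exponent `x^U y^W` (`U, W ⊆ Fin h`). -/
theorem coeff_truncate_partition {h : ℕ} (f : MvPolynomial (Fin (h + h)) ℂ) (U W : Finset (Fin h)) :
    MvPolynomial.coeff (∑ a ∈ U, Finsupp.single (Fin.castAdd h a) 1 +
        ∑ c ∈ W, Finsupp.single (Fin.natAdd h c) 1)
      (∑ e ∈ Finset.range (h + h + 1), MvPolynomial.homogeneousComponent e f) =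
    MvPolynomial.coeff (∑ a ∈ U, Finsupp.single (Fin.castAdd h a) 1 +
        ∑ c ∈ W, Finsupp.single (Fin.natAdd h c) 1) f := by
  rw [MvPolynomial.coeff_sum]
  simp_rw [MvPolynomial.coeff_homogeneousComponent, degree_partitionExpo]
  rw [Finset.sum_ite_eq (Finset.range (h + h + 1)) (U.card + W.card)
    (fun _ => MvPolynomial.coeff _ f), if_pos]
  rw [Finset.mem_range]
  have hU : U.card ≤ h := (Finset.card_le_univ U).trans (by simp)
  have hW : W.card ≤ h := (Finset.card_le_univ W).trans (by simp)
  omega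

/-- The truncation has total degree `≤ h + h`. -/
theorem totalDegree_truncate_le {h : ℕ} (f : MvPolynomial (Fin (h + h)) ℂ) :
    (∑ e ∈ Finset.range (h + h + 1), MvPolynomial.homogeneousComponent e f).totalDegree ≤ h + h := by
  refine (MvPolynomial.totalDegree_finsetSum _ _).trans (Finset.sup_le fun e he => ?_)
  have he' : e ≤ h + h := by rw [Finset.mem_range] at he; omega
  exact ((MvPolynomial.homogeneousComponent_isHomogeneous e f).totalDegree_le).trans he'

end Summit.ValiantsHypothesis.ValiantsHypothesis.Theorems.BarrierLever.StrataDoor
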